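/-
Copyright: width seat `ym-line-sll-p2` (prover-ym-line-sll-p2-g2-0), route `SoftLoopLongLag`, crux T′ `ColdBoxSoftLoopLagFloor`
(stmt-QuantumFields-24180), line `birth`, registered stub E1a `stub_innerFlatLagFloorG` — CLOSED here.
-/
import Summits.QuantumFields.YangMills.Theorems.SoftLoopLongLagInnerFlatReduction
import Summits.QuantumFields.YangMills.Theorems.SoftLoopLongLagInnerFlatExponents2
import Summits.QuantumFields.YangMills.Theorems.ColdBoxAllGroupsBoxFloorAllGroupsStubBoxDirichletDominationAbsG
import Summits.QuantumFields.YangMills.Theorems.BalabanLadderNTOnePointFloor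

/-!
# Route `SoftLoopLongLag`, crux T′ `ColdBoxSoftLoopLagFloor` (stmt-QuantumFields-24180), line `birth`: the registered stub E1a
# `stub_innerFlatLagFloorG` — the INNER FLAT LAG FLOOR, every compact simple `G` (PROVED)

For every compact simple `G` (tree sense) and `r : LatticeRep G` there are `d = D/(2N²) > 0` (`D = dimE r.ρ`, `N = r.N`) and `a₀ = 1/100`
such that for all `0 < ε`, `4ε ≤ a ≤ a₀` there are `γ = a > 0` and `β₀` with: for `β ≥ β₀`, `R = ⌈β^ε⌉`, `H = ⌈β^a⌉`,
`d·wickLagSum R R − β^{−γ}R³ ≤ β²·lagCov (boxKernelG r.ρ β H 1) (softLoopObs r R ∘ configShift (−boxCentre H)) R` — the lag-`R`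
autocovariance of the cube-smeared soft loop, translated to the centre of the cold-wall box `[0,2H]⁴` of the sibling route `ColdBoxAllGroups`
with the FLAT datum (`boxKernelG … 1 = boxState`), is bounded below by the Gaussian Wick floor.

Assembly of the line's E1a bricks (all landed): the fixed-`β` reduction `beta_sq_lagCov_flat_ge` (brick 6: translation, conditioning on small
fields, the loop one-scale core = bricks 1–5 on the sibling's engine `integral_cond_boxState_eq_integral_tilted_G'`, Dirichlet-vs-free
inductances) fed with the sibling's window (`eventually_oneScale_boundsG`, `eventually_linkWindow_subset_image_expChart`,
`exists_chartMeasureE_restrict_closedBall_eq_withDensity`, `boxState_coldGoodSetG_ne_zero`, `boxState_real_compl_coldGoodSetG_le`) at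
`θ = a`, small-field scale `3a`, link radius `m = 2η_β`, Gaussian radius `β^{3a}/(2(√D+1))`; the six error terms are `≤ β^{−a}/6` eventually
(§2–§3: monomial bookkeeping in `β^ε`, `β^a`; the binding exponent is `10ε + 39a − 1/2 < −a`).
No sorry; no new definition; standard axioms.  HONEST LABEL: rung R2xi-G RECORD label (leaf `WeakCouplingRates.XiPow`, an UPPER bound on the
lattice mass gap for every compact simple `G`); NOT the Clay mass gap; no summit statement is touched.
-/
set_option autoImplicit false

noncomputable section

open MeasureTheory ProbabilityTheory Finset Real Filter Topology Metric
open Literature.Probability.LatticeModels (Site)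
open Literature.MathematicalPhysics.QuantumLattice
open scoped Matrix.Norms.Frobenius
open Literature.MathematicalPhysics.QuantumFieldTheory (LatticeRep IsCompactSimpleLieGroup)
open Literature.MathematicalPhysics.QuantumFieldTheory.LatticeMaxwell
open Literature.MathematicalPhysics.QuantumFieldTheory.AxialGauge
open Summit.QuantumFields.YangMills.Theorems.WeakCouplingRates
open Summit.QuantumFields.YangMills.Theorems.FreeEnergyLogCoefficient
open Summit.QuantumFields.YangMills.Theorems.ColdBoxAllGroups

namespace Summit.QuantumFields.YangMills.Theorems.SoftLoopLongLag

/-! ## §4 The stub -/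

/-- A faithful representation with a non-trivial Lie algebra acts on a space of positive dimension: `0 < dimE r.ρ → 0 < r.N`. -/
theorem latticeRep_N_pos {G : Type} [Group G] [TopologicalSpace G] (r : LatticeRep G) (hD : 0 < dimE r.ρ) : 0 < r.N := by
  refine Nat.pos_of_ne_zero fun hN0 => ?_
  haveI : IsEmpty (Fin r.N) := ⟨fun i => by have := i.isLt; omega⟩
  haveI : Subsingleton (Matrix (Fin r.N) (Fin r.N) ℂ) := inferInstance
  set v : EuclideanSpace ℝ (Fin (dimE r.ρ)) := PiLp.single 2 (⟨0, hD⟩ : Fin (dimE r.ρ)) (1 : ℝ) with hv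
  have h1 : ‖v‖ = 1 := by rw [hv, PiLp.norm_single, norm_one]
  have h2 : ‖lieIso r.ρ v‖ = 0 := by rw [Subsingleton.elim (lieIso r.ρ v) 0, norm_zero]
  rw [norm_lieIso] at h2
  linarith

set_option maxHeartbeats 800000 in
/-- **Stub E1a `stub_innerFlatLagFloorG` of crux T′ `ColdBoxSoftLoopLagFloor` (stmt-QuantumFields-24180), line `birth`, registered signature
verbatim — PROVED.**  See the module docstring. -/
theorem stub_innerFlatLagFloorG :
    ∀ (G : Type) [Group G] [TopologicalSpace G] [IsTopologicalGroup G] [CompactSpace G] [MeasurableSpace G] [BorelSpace G],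
    IsCompactSimpleLieGroup G → ∀ r : LatticeRep G, ∃ d a₀ : ℝ, 0 < d ∧ 0 < a₀ ∧
      ∀ ε a : ℝ, 0 < ε → 4 * ε ≤ a → a ≤ a₀ → ∃ γ β₀ : ℝ, 0 < γ ∧ ∀ β : ℝ, β₀ ≤ β →
        d * wickLagSum ⌈β ^ ε⌉₊ ⌈β ^ ε⌉₊ - β ^ (-γ) * (⌈β ^ ε⌉₊ : ℝ) ^ 3 ≤
          β ^ 2 * lagCov (boxKernelG r.ρ β ⌈β ^ a⌉₊ (fun _ => 1))
            (fun U => softLoopObs r ⌈β ^ ε⌉₊ (configShift (-(boxCentre ⌈β ^ a⌉₊)) U)) ⌈β ^ ε⌉₊ := by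
  intro G _ _ _ _ _ _ hG r
  haveI : SecondCountableTopology (Matrix (Fin r.N) (Fin r.N) ℂ) := inferInstanceAs (SecondCountableTopology (Fin r.N → Fin r.N → ℂ))
  haveI : SecondCountableTopology G := (r.continuous.isClosedEmbedding r.injective).isEmbedding.secondCountableTopology
  have hD1 : 0 < dimE r.ρ := Summit.QuantumFields.YangMills.Cruxes.NT.LinkEquipartition.dimE_pos_of_isCompactSimpleLieGroup G r hG
  have hNpos : 0 < r.N := latticeRep_N_pos r hD1
  have hDr : (0 : ℝ) < dimE r.ρ := by exact_mod_cast hD1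
  have hNr : (1 : ℝ) ≤ r.N := by exact_mod_cast hNpos
  -- the constants of the line
  obtain ⟨r₂, C₂, cH, hr₂, -, hC₂, hcH, Jd, hJc, hJb, hJhalf, hdens⟩ :=
    exists_chartMeasureE_restrict_closedBall_eq_withDensity r.ρ r.continuous r.injective r.mem_unitary
  obtain ⟨K_D, hKD0, hKD⟩ := exists_abs_dirInductance_sub_mutualInductance_le
  obtain ⟨C_M, hCM0, hCM⟩ := sum_sum_abs_mutualInductance_lag_le
  refine ⟨(dimE r.ρ : ℝ) / (2 * (r.N : ℝ) ^ 2), 1 / 100, by positivity, by norm_num, fun ε a hε h4ε ha1 => ?_⟩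
  have ha : 0 < a := by linarith
  have hεa : ε < a := by linarith
  have hs : ε + (5 * a - 1 / 2) ≤ 0 := by linarith
  have hwin5 : 2 * a + 3 * a < 1 / 2 := by linarith
  -- eventual facts
  have hE := eventually_oneScale_boundsG r.N (dimE r.ρ) ha ha1 hr₂ hC₂
  have hW := eventually_linkWindow_subset_image_expChart r.ρ r.continuous r.injective r.mem_unitary (ε := 3 * a) ha.le hwin5 one_pos
  obtain ⟨β₂, hcondE⟩ := boxState_real_compl_coldGoodSetG_le r.ρ r.continuous r.mem_unitary ha (by linarith : 2 * a < 3 * a)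
  obtain ⟨β₃, hG0E⟩ := boxState_coldGoodSetG_ne_zero r.ρ r.continuous r.mem_unitary ha (by linarith : 2 * a < 3 * a)
  have hX := (eventually_loopRadius_le hε.le ha.le (by linarith)).and ((eventually_box_deep hε.le hεa).and
    ((eventually_err1_le (dimE r.ρ) hKD0 hCM0 hε h4ε).and ((eventually_err2_le hC₂.le hε h4ε ha1).and
    ((eventually_err3_le (dimE r.ρ) hε ha hs).and ((eventually_err4_le (dimE r.ρ) hε h4ε ha1).and
    ((eventually_err5_le (dimE r.ρ) hε ha hs).and (eventually_err6_le r.N hε ha)))))))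
  obtain ⟨β₁, hβ₁⟩ := Filter.eventually_atTop.1 (hE.and (hW.and hX))
  refine ⟨a, max β₁ (max β₂ β₃), ha, fun β hβ => ?_⟩
  have hb₁ : β₁ ≤ β := (le_max_left _ _).trans hβ
  have hb₂ : β₂ ≤ β := ((le_max_left _ _).trans (le_max_right _ _)).trans hβ
  have hb₃ : β₃ ≤ β := ((le_max_right _ _).trans (le_max_right _ _)).trans hβ
  obtain ⟨⟨hβ1, hm4, hmr₂, hmEm, hwin, hp1, -⟩, ⟨-, hball⟩, htR, ⟨h24, h32⟩, hP1, hP2, hP3, hP4, hP5, hP6⟩ := hβ₁ β hb₁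
  have hβ0 : 0 < β := by linarith
  -- names
  set H : ℕ := ⌈β ^ a⌉₊ with hHdef
  set R : ℕ := ⌈β ^ ε⌉₊ with hRdef
  set η : ℝ := (12 * (H : ℝ) ^ 2 + 2 * H + 1) * (Real.sqrt 2 * Real.sqrt (β ^ (2 * (3 * a) - 1))) with hηdef
  set m : ℝ := 2 * η with hmdef
  set Rw : ℝ := β ^ (3 * a) / (2 * (Real.sqrt (dimE r.ρ) + 1)) with hRwdef
  set p : ℝ := 240 * (dimE r.ρ : ℝ) * (2 * (H : ℝ) + 1) ^ 4 * Real.exp (-Rw ^ 2 / 2) with hpdef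
  set ℓ : ℝ := 2 * C₂ * m ^ 2 with hℓdef
  have hH : 1 ≤ H := by
    have := (one_le_ceil_rpow_and_le (A := a) hβ1 ha.le).1
    exact_mod_cast this
  have hη0 : 0 < η := by
    have : 0 < Real.sqrt (β ^ (2 * (3 * a) - 1)) := Real.sqrt_pos.2 (Real.rpow_pos_of_pos hβ0 _)
    positivity
  have hm0 : 0 < m := by positivity
  have hℓ0 : 0 ≤ ℓ := by positivity
  have hRw0 : 0 ≤ Rw := by positivity
  have hmE4 : Real.sqrt (dimE r.ρ) * ((12 * (H : ℝ) ^ 2 + 2 * H + 1) * Rw) / Real.sqrt β ≤ 1 / 4 := hmEm.trans hm4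
  -- the chart density at radius `m`
  have hgpos : ∀ x : EuclideanSpace ℝ (Fin (dimE r.ρ)), ‖x‖ ≤ m → 0 < Jd x := fun x hx => by
    linarith [(hJhalf x (hx.trans hmr₂)).1]
  have hg : ∀ x : EuclideanSpace ℝ (Fin (dimE r.ρ)), ‖x‖ ≤ m → |Real.log (Jd x)| ≤ ℓ := fun x hx => by
    refine (abs_log_jacobian_le hJb hJhalf x (hx.trans hmr₂)).trans ?_
    rw [hℓdef]
    have : ‖x‖ ^ 2 ≤ m ^ 2 := pow_le_pow_left₀ (norm_nonneg _) hx 2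
    nlinarith
  have hc0 : ENNReal.ofReal cH ≠ 0 := by rw [ENNReal.ofReal_ne_zero_iff]; exact hcH
  have hdensm := hdens m hm0 hmr₂
  -- the two charged events
  have hG0 : boxState r.ρ β H (coldGoodSetG r.ρ H β (3 * a)) ≠ 0 := hG0E β hb₃
  haveI : IsProbabilityMeasure (gaussD H (dimE r.ρ)) := isProbabilityMeasure_gaussD H (dimE r.ρ)
  have hSm : MeasurableSet (goodTE r.ρ H β (3 * a) ∩ {t | ∀ e, ‖unscaleTE H (dimE r.ρ) β t e‖ ≤ m}) :=
    (measurableSet_goodTE r.ρ r.continuous r.injective β (3 * a)).inter (measurableSet_ball_unscaleTE (dimE r.ρ) β m)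
  have hpS : (gaussD H (dimE r.ρ)).real (goodTE r.ρ H β (3 * a) ∩ {t | ∀ e, ‖unscaleTE H (dimE r.ρ) β t e‖ ≤ m})ᶜ ≤ p :=
    gaussD_real_compl_goodTE_inter_ball_le r.ρ r.continuous hβ0 hH hRw0 hmE4 hmEm hwin
  have hγ : gaussD H (dimE r.ρ) (goodTE r.ρ H β (3 * a) ∩ {t | ∀ e, ‖unscaleTE H (dimE r.ρ) β t e‖ ≤ m}) ≠ 0 :=
    measure_ne_zero_of_real_compl_lt_one _ hSm (hpS.trans_lt hp1)
  -- the representation (B4') at radius `m`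
  have hrep : ∀ X : LGConfig 4 G → ℝ, Measurable X → IsZdGaugeInvariant X → (∀ U, 0 ≤ X U) →
      ∫ U, X U ∂((boxState r.ρ β H)[|coldGoodSetG r.ρ H β (3 * a)]) =
        ∫ t, X (cfgTE r.ρ H β t) ∂(((gaussD H (dimE r.ρ))[|(goodTE r.ρ H β (3 * a) ∩ {t | ∀ e, ‖unscaleTE H (dimE r.ρ) β t e‖ ≤ m})]).tilted
          ((goodTE r.ρ H β (3 * a) ∩ {t | ∀ e, ‖unscaleTE H (dimE r.ρ) β t e‖ ≤ m}).indicator (tiltWE r.ρ H Jd β))) :=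
    fun X hXm hXinv hX0 => integral_cond_boxState_eq_integral_tilted_G' r.ρ r.continuous r.injective r.mem_unitary hβ0 hH hm4 hball
      hJc.measurable hgpos hc0 ENNReal.ofReal_ne_top hdensm hG0 hγ hXm hXinv hX0
  -- the reduction at fixed `β`
  have hred := beta_sq_lagCov_flat_ge r (ε := 3 * a) (q := Real.exp (-(β ^ (3 * a)))) (K_D := K_D) (C_M := C_M) (H := H) (R := R)
    hJc.measurable hβ1 hH hm0.le hm4 hℓ0 hg hRw0 htR hmE4 hmEm hwin (le_refl p) hp1 hrep hG0 (hcondE β hb₂) hKD0 h24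
    (fun x y hx hy => hKD H h32 x y R hx hy) (hCM R R le_rfl)
  -- the six errors are `≤ β^{-a}/6` each
  have hτ0 : 0 ≤ 190 * β * m ^ 3 := by positivity
  have hw := tiltSize_le_cardBound H hτ0 hℓ0
  have hM20 : 0 ≤ 3 * (((timeZeroCube R).card : ℝ) * (β * (4 * R * m) ^ 2 / 2 + 9 * β * (4 * R * m) ^ 3)) ^ 2 := by positivity
  have hP2' : 3 * (((timeZeroCube R).card : ℝ) * (β * (4 * R * m) ^ 2 / 2 + 9 * β * (4 * R * m) ^ 3)) ^ 2 *
      (Real.exp (2 * (((#(plaquettesTouching (boxEdges 4 (2 * H + 1))) : ℝ) * (190 * β * m ^ 3) +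
        (Fintype.card (ColdFreeIdx H) : ℝ) * ℓ))) - 1) ≤ β ^ (-a) / 6 := by
    refine le_trans ?_ hP2
    refine mul_le_mul_of_nonneg_left (sub_le_sub_right (Real.exp_le_exp.2 ?_) 1) hM20
    linarith only [hw]
  -- the target precision
  have hx0 : 0 ≤ β ^ (-a) := by positivity
  have hR3 : (1 : ℝ) ≤ (R : ℝ) ^ 3 := one_le_pow₀ ((one_le_ceil_rpow_and_le (A := ε) hβ1 hε.le).1)
  have hN2 : (0 : ℝ) ≤ ((r.N : ℝ) ^ 2)⁻¹ := by positivity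
  have hN1 : ((r.N : ℝ) ^ 2)⁻¹ ≤ 1 := inv_le_one_of_one_le₀ (one_le_pow₀ hNr)
  rw [boxKernelG_one]
  refine le_trans ?_ hred
  have hErr : (dimE r.ρ : ℝ) / 2 * (2 * (K_D * (R : ℝ) ^ 4 / (H : ℝ) ^ 4) * (C_M * ((timeZeroCube R).card : ℝ) ^ 2)) +
      ((3 * (((timeZeroCube R).card : ℝ) * (β * (4 * R * m) ^ 2 / 2 + 9 * β * (4 * R * m) ^ 3)) ^ 2 *
          (Real.exp (2 * (((#(plaquettesTouching (boxEdges 4 (2 * H + 1))) : ℝ) * (190 * β * m ^ 3) +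
            (Fintype.card (ColdFreeIdx H) : ℝ) * ℓ))) - 1) +
        6 * (((timeZeroCube R).card : ℝ) * (β * (4 * R * m) ^ 2 / 2 + 9 * β * (4 * R * m) ^ 3)) ^ 2 * p +
        2 * (((timeZeroCube R).card : ℝ) * (9 * β * (4 * R * m) ^ 3)) *
          (((timeZeroCube R).card : ℝ) * (β * (4 * R * m) ^ 2 / 2 + 9 * β * (4 * R * m) ^ 3) +
            (dimE r.ρ : ℝ) * ((timeZeroCube R).card : ℝ) * (R : ℝ) ^ 4) +
        Real.sqrt p * (2 * (((timeZeroCube R).card : ℝ) * (β * (4 * R * m) ^ 2 / 2 + 9 * β * (4 * R * m) ^ 3)) *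
          ((dimE r.ρ : ℝ) * ((timeZeroCube R).card : ℝ) * (R : ℝ) ^ 4) +
          3 * ((dimE r.ρ : ℝ) * ((timeZeroCube R).card : ℝ) * (R : ℝ) ^ 4) ^ 2 + ((dimE r.ρ : ℝ) * ((timeZeroCube R).card : ℝ) * (R : ℝ) ^ 4) ^ 2)) +
        6 * (((timeZeroCube R).card : ℝ) * (β * (2 * r.N))) * (((timeZeroCube R).card : ℝ) * (β * (2 * r.N))) * Real.exp (-(β ^ (3 * a)))) ≤
      β ^ (-a) := by linarith only [hP1, hP2', hP3, hP4, hP5, hP6]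
  have hNE := mul_le_mul_of_nonneg_left hErr hN2
  have hNx : ((r.N : ℝ) ^ 2)⁻¹ * β ^ (-a) ≤ β ^ (-a) := by
    have := mul_le_mul_of_nonneg_right hN1 hx0
    rwa [one_mul] at this
  have hd : (dimE r.ρ : ℝ) / (2 * (r.N : ℝ) ^ 2) * wickLagSum R R = ((r.N : ℝ) ^ 2)⁻¹ * ((dimE r.ρ : ℝ) / 2 * wickLagSum R R) := by
    field_simp
  have hRx : β ^ (-a) ≤ β ^ (-a) * (R : ℝ) ^ 3 := by
    have := mul_le_mul_of_nonneg_left hR3 hx0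
    rwa [mul_one] at this
  have hfin := hNE.trans (hNx.trans hRx)
  rw [hd, mul_sub]
  exact sub_le_sub_left hfin _

end Summit.QuantumFields.YangMills.Theorems.SoftLoopLongLag

end
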